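import Summits.BirchSwinnertonDyer.BirchSwinnertonDyer.Theorems.ResidualThetaTransportAtTwoResidualSignedLambdaLowerCMAtTwoCofreeLimitFamily
import HarnessLib

/-!
# The bridge-free Kőnig family of RSL_g with solution sets typed only FROM A LEVEL FLOOR `N₀`
# (`Sol n k` for `n ≥ N₀` ⇒ ONE element of Kato's `𝐇¹_Γ(T_ρ)` with `red_{p^k}(proj_n x) ∈ Sol n k` for every `n ≥ N₀`)

Route `ResidualThetaTransportAtTwo` (RTT), crux RSL_g `ResidualSignedLambdaLowerCMAtTwo` (stmt-BirchSwinnertonDyer-22608); width seat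
`prover-bsd-wall-tp2-p2x-w3` g15 (`--supports 22608 --as helper`, closes nothing). THEOREMS ONLY (no definition, no named fact, no
instance, no `sorry`). Stub plan rev 16 S67 / unit test U55 («Sol BELOW THE FLOOR») for the holders of items 6/7 of `Lines/onepair.lean`
(`stub_deepHalfAtTwoStrict`, `stub_deepHalfAwayTwo`): the bridge-free theorems `ThetaTransport.exists_layerFamily_of_levelwise` /
`ThetaTransport.exists_iwasawaH1_of_levelwise` (file `…CofreeLimitFamily.lean`) index `Sol n k` from `n = 0`, while the `S₀`-side pins of the
split stubs are typed only from the level floor `n ≥ n_w` (T37 / S61; `N₀(S₀) := max_{w ∈ S₀} n_w`). Here the four levelwise inputs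
`hfin` / `hne` / `hSk` / `hSn` are demanded ONLY for `N₀ ≤ n` and the conclusion is stated for `N₀ ≤ n`; the levels below the floor are
filled by the DEFAULT of S67 — `Sol' n k := cor_{ℚ_{N₀} → ℚ_n} (Sol N₀ k)` — inside the proof (`exists_extension_below_floor`):
`hSn` below `N₀` is transitivity of corestriction (`coresLe_comp`), `hSk` below `N₀` is the commuting square `[p]_* ∘ Cor = Cor ∘ [p]_*`
(`cohomologyMap_coresLe`), finiteness / non-emptiness transfer along `Cor` as images, and the diagonal `Sol N₀ j ≠ ∅` for `j < N₀` follows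
from `Sol N₀ N₀ ≠ ∅` by iterating `hSk`. No arithmetic.

* `exists_extension_below_floor` — the extension `Sol'` with the four properties at EVERY level and `Sol' n k = Sol n k` for `N₀ ≤ n`
  (no compactness hypothesis).
* `exists_layerFamily_of_levelwise_from` — the `Cor`-compatible family `y n ∈ H¹(ℚ_n, T_ρ)` with `red_{p^k} y_n ∈ Sol n k` for `N₀ ≤ n`.
* `exists_iwasawaH1_of_levelwise_from` — for the cyclotomic `κ` and a pinned `I : IwasawaH1DataCoeff ρ.toGaloisRep p κ γ`, an `x : I.H`
  with `red_{p^k} (I.proj n x) ∈ Sol n k` for `N₀ ≤ n`.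
* `…_of_finiteDimensional` variants (`[FiniteDimensional ℚ_[p] ℚ_p(S)]` instead of `[CompactSpace 𝒪]`).

References: K. Kato, Astérisque 295 (2004), §12.2 (p. 220: "the inverse limit is taken with respect to trace maps"), §13.8 (p. 228)
[Kato2004Asterisque]; K. Rubin, *Euler Systems* (2000), App. B Prop. B.2.3, §B.3 [Rubin2000]; J. Neukirch, A. Schmidt, K. Wingberg,
*Cohomology of Number Fields* (2008), I §5 Prop. 1.5.3 (iii) (transitivity of corestriction) [NeukirchSchmidtWingberg2008]. Tree:
`…CofreeLimitFamily.lean` (tp2-p2x LEAD g17), `…CofreeLevelwiseKonig.lean` (w3 g14), `ContinuousCorestrictionComp.lean` (`coresLe_comp`),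
`IwasawaTwistModPShapiroCores.lean` (`cohomologyMap_coresLe`). BSD is not proved by any of this; RSL_g (22608) is not proved here.
-/

set_option autoImplicit false
-- the Theorems namespace of this sub repeats the summit name by design (D-0017 nested layout)
set_option linter.dupNamespace false

noncomputable section

open scoped Classical

namespace Summit.BirchSwinnertonDyer.BirchSwinnertonDyer.Theorems.ThetaTransport

open CategoryTheory Field
  Literature.NumberTheory.EllipticCurves Literature.NumberTheory.GaloisRepresentations
  Literature.NumberTheory.EllipticCurves.GreenbergSelmer Literature.NumberTheory.EllipticCurves.CyclotomicLayer
  Literature.NumberTheory.EllipticCurves.Kato2004 ZpExtension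
  Summit.BirchSwinnertonDyer.BirchSwinnertonDyer.Theorems.CofreeLevelwiseKonig

variable {p : ℕ} [Fact p.Prime] (S : Set (PadicAlgCl p)) {d : ℕ} (ρ : FramedGaloisRep ℚ ↥(padicCoeffIntegers S) d)
  (κ : ZpExtension ℚ p)

/-- **Extension below the floor** (S67's default): levelwise solution sets `Sol n k ⊆ H¹(ℚ_n, A_ρ[p^k])` that are finite, diagonally
non-empty, `[p]_*`- and `Cor`-stable FROM THE LEVEL `N₀` on extend to solution sets `Sol'` with the same four properties at EVERY level
and `Sol' n k = Sol n k` for `N₀ ≤ n`: put `Sol' n k := cor_{ℚ_{N₀} → ℚ_n}(Sol N₀ k)` for `n < N₀`. `Cor`-stability below `N₀` is the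
transitivity of corestriction, `[p]_*`-stability the naturality of `Cor` in the coefficient morphism, and `Sol N₀ j ≠ ∅` for `j < N₀`
follows from `Sol N₀ N₀ ≠ ∅` by iterating `[p]_*`. [cite: NeukirchSchmidtWingberg2008, I §5 Prop. 1.5.3]
[cite: Kato2004Asterisque, §12.2 (p. 220)] -/
theorem exists_extension_below_floor (N₀ : ℕ)
    (Sol : ∀ n k : ℕ, Set (H1 (cofreeTorsionGaloisModule S ρ ((p ^ k : ℕ) : ℤ)) (κ.layerSubgroup n)))
    (hfin : ∀ n k, N₀ ≤ n → (Sol n k).Finite) (hne : ∀ j, N₀ ≤ j → (Sol j j).Nonempty)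
    (hSk : ∀ n k, N₀ ≤ n →
      ∀ c ∈ Sol n (k + 1), cohomologyMap (subgroupRepMap (cofreeTorsionPow S ρ k) (κ.layerSubgroup n)) 1 c ∈ Sol n k)
    (hSn : ∀ n k, N₀ ≤ n →
      ∀ c ∈ Sol (n + 1) k, layerCores (cofreeTorsionGaloisModule S ρ ((p ^ k : ℕ) : ℤ)) κ n c ∈ Sol n k) :
    ∃ Sol' : ∀ n k : ℕ, Set (H1 (cofreeTorsionGaloisModule S ρ ((p ^ k : ℕ) : ℤ)) (κ.layerSubgroup n)),
      (∀ n k, N₀ ≤ n → Sol' n k = Sol n k) ∧ (∀ n k, (Sol' n k).Finite) ∧ (∀ j, (Sol' j j).Nonempty) ∧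
      (∀ n k, ∀ c ∈ Sol' n (k + 1),
        cohomologyMap (subgroupRepMap (cofreeTorsionPow S ρ k) (κ.layerSubgroup n)) 1 c ∈ Sol' n k) ∧
      (∀ n k, ∀ c ∈ Sol' (n + 1) k, layerCores (cofreeTorsionGaloisModule S ρ ((p ^ k : ℕ) : ℤ)) κ n c ∈ Sol' n k) := by
  haveI : CompactSpace (absoluteGaloisGroup ℚ) := absoluteGaloisGroup_compactSpace ℚ
  haveI hFI : ∀ m : ℕ, (κ.layerSubgroup m).FiniteIndex := fun m ↦
    finiteIndex_of_isOpen_of_compactSpace _ (κ.isOpen_layerSubgroup m)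
  letI hFT : ∀ a b : ℕ, Fintype (↥(κ.layerSubgroup a) ⧸ (κ.layerSubgroup b).subgroupOf (κ.layerSubgroup a)) :=
    fun a b ↦ Fintype.ofFinite _
  -- the corestriction from the floor `ℚ_{N₀}` down to `ℚ_n`, `n ≤ N₀`, with `A_ρ[p^k]`-coefficients
  let cor : ∀ (k n : ℕ), n ≤ N₀ →
      (H1 (cofreeTorsionGaloisModule S ρ ((p ^ k : ℕ) : ℤ)) (κ.layerSubgroup N₀) →ₗ[ℤ]
        H1 (cofreeTorsionGaloisModule S ρ ((p ^ k : ℕ) : ℤ)) (κ.layerSubgroup n)) :=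
    fun k n h ↦ coresLe (cofreeTorsionGaloisModule S ρ ((p ^ k : ℕ) : ℤ)).toTopRep (κ.layerSubgroup_antitone h)
      (κ.isOpen_layerSubgroup N₀)
  -- non-emptiness of `Sol N₀ j` for every `j ≤ N₀` (iterate `[p]_*` down from the diagonal entry `Sol N₀ N₀`)
  have hne₀ : ∀ i j : ℕ, j + i = N₀ → (Sol N₀ j).Nonempty := by
    intro i
    induction i with
    | zero =>
      intro j hj
      rw [Nat.add_zero] at hj
      subst hj
      exact hne j le_rfl
    | succ i ih =>
      intro j hj
      obtain ⟨c, hc⟩ := ih (j + 1) (by omega)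
      exact ⟨_, hSk N₀ j le_rfl c hc⟩
  refine ⟨fun n k ↦ if h : N₀ ≤ n then Sol n k else cor k n (Nat.le_of_not_ge h) '' Sol N₀ k,
    fun n k hn ↦ by simp only [dif_pos hn], fun n k ↦ ?_, fun j ↦ ?_, fun n k c hc ↦ ?_, fun n k c hc ↦ ?_⟩
  · -- finiteness
    by_cases hn : N₀ ≤ n
    · simp only [dif_pos hn]
      exact hfin n k hn
    · simp only [dif_neg hn]
      exact (hfin N₀ k le_rfl).image _
  · -- diagonal non-emptiness
    by_cases hj : N₀ ≤ j
    · simp only [dif_pos hj]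
      exact hne j hj
    · simp only [dif_neg hj]
      exact (hne₀ (N₀ - j) j (by omega)).image _
  · -- `[p]_*`-stability
    by_cases hn : N₀ ≤ n
    · simp only [dif_pos hn] at hc ⊢
      exact hSk n k hn c hc
    · simp only [dif_neg hn] at hc ⊢
      obtain ⟨y, hy, rfl⟩ := hc
      refine ⟨_, hSk N₀ k le_rfl y hy, ?_⟩
      rw [cohomologyMap_coresLe (κ.layerSubgroup_antitone (Nat.le_of_not_ge hn)) (κ.isOpen_layerSubgroup N₀)
        (subgroupRepMap (cofreeTorsionPow S ρ k) (κ.layerSubgroup n)) y, restrictHomOfLe_subgroupRepMap]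
  · -- `Cor`-stability
    by_cases hn : N₀ ≤ n
    · have hn1 : N₀ ≤ n + 1 := Nat.le_succ_of_le hn
      simp only [dif_pos hn, dif_pos hn1] at hc ⊢
      exact hSn n k hn c hc
    · by_cases hn1 : N₀ ≤ n + 1
      · -- the floor itself: `N₀ = n + 1`, and `layerCores` IS the one-step `coresLe`
        have hN : N₀ = n + 1 := le_antisymm hn1 (Nat.lt_of_not_ge hn)
        simp only [dif_neg hn, dif_pos hn1] at hc ⊢
        refine ⟨hN ▸ c, ?_, ?_⟩
        · subst hN
          exact hc
        · subst hN
          exact (TwistTate.layerCores_eq_coresLe (κ := κ) (n := n) (c := c)).symm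
      · simp only [dif_neg hn, dif_neg hn1] at hc ⊢
        obtain ⟨y, hy, rfl⟩ := hc
        refine ⟨y, hy, ?_⟩
        rw [TwistTate.layerCores_eq_coresLe (κ := κ) (n := n)]
        have e := congrArg (fun f ↦ f y)
          (coresLe_comp (cofreeTorsionGaloisModule S ρ ((p ^ k : ℕ) : ℤ)).toTopRep
            (κ.layerSubgroup_antitone (Nat.le_of_not_ge hn1)) (κ.layerSubgroup_antitone (Nat.le_succ n))
            (κ.isOpen_layerSubgroup N₀) (κ.isOpen_layerSubgroup (n + 1)))
        simp only [LinearMap.coe_comp, Function.comp_apply] at e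
        exact e.symm

/-- **Levelwise solution sets FROM A FLOOR ⇒ ONE cores-compatible family `y n ∈ H¹(ℚ_n, T_ρ)`, all bridges discharged** (`𝒪` compact):
finite, diagonally non-empty, `[p]_*`/`Cor`-stable `Sol n k ⊆ H¹(ℚ_n, A_ρ[p^k])` for `N₀ ≤ n` ⇒ a `Cor`-compatible `y` with
`red_{p^k} y_n ∈ Sol n k` for every `N₀ ≤ n` (`exists_layerFamily_of_levelwise` on the extension below the floor).
[cite: Kato2004Asterisque, §12.2 (p. 220), §13.8 (p. 228)] [cite: Rubin2000, App. B Prop. B.2.3 and §B.3] -/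
theorem exists_layerFamily_of_levelwise_from [CompactSpace ↥(padicCoeffIntegers S)] (N₀ : ℕ)
    (Sol : ∀ n k : ℕ, Set (H1 (cofreeTorsionGaloisModule S ρ ((p ^ k : ℕ) : ℤ)) (κ.layerSubgroup n)))
    (hfin : ∀ n k, N₀ ≤ n → (Sol n k).Finite) (hne : ∀ j, N₀ ≤ j → (Sol j j).Nonempty)
    (hSk : ∀ n k, N₀ ≤ n →
      ∀ c ∈ Sol n (k + 1), cohomologyMap (subgroupRepMap (cofreeTorsionPow S ρ k) (κ.layerSubgroup n)) 1 c ∈ Sol n k)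
    (hSn : ∀ n k, N₀ ≤ n →
      ∀ c ∈ Sol (n + 1) k, layerCores (cofreeTorsionGaloisModule S ρ ((p ^ k : ℕ) : ℤ)) κ n c ∈ Sol n k) :
    ∃ y : ∀ n : ℕ, H1 (FramedGaloisRep.toGaloisRep ρ) (κ.layerSubgroup n),
      (∀ n k, N₀ ≤ n → (reduceH1CofreePkTorsion S ρ k (κ.layerSubgroup n) (y n) :
          H1 (cofreeTorsionGaloisModule S ρ ((p ^ k : ℕ) : ℤ)) (κ.layerSubgroup n)) ∈ Sol n k) ∧
      ∀ n, layerCores (FramedGaloisRep.toGaloisRep ρ) κ n (y (n + 1)) = y n := by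
  obtain ⟨Sol', hSol', hfin', hne', hSk', hSn'⟩ := exists_extension_below_floor S ρ κ N₀ Sol hfin hne hSk hSn
  obtain ⟨y, hy, hcomp⟩ := exists_layerFamily_of_levelwise S ρ κ Sol' hfin' hne' hSk' hSn'
  exact ⟨y, fun n k hn ↦ hSol' n k hn ▸ hy n k, hcomp⟩

/-- **Levelwise solution sets FROM A FLOOR ⇒ ONE element of Kato's `𝐇¹_Γ(T_ρ)`, all bridges discharged**: for the CYCLOTOMIC `κ`, `𝒪`
compact and a pinned datum `I : IwasawaH1DataCoeff ρ.toGaloisRep p κ γ`, finite / diagonally non-empty / `[p]_*`- and `Cor`-stable solution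
sets `Sol n k ⊆ H¹(ℚ_n, A_ρ[p^k])` for `N₀ ≤ n` yield `x : I.H` with `red_{p^k} (I.proj n x) ∈ Sol n k` for every `N₀ ≤ n` — the
slot-(c) output of items 6/7 of `Lines/onepair.lean` for solution sets typed from the level floor `N₀(S₀)` (S61/S67).
[cite: Kato2004Asterisque, Lemma 8.5 (2) (p. 183), §12.2 (p. 220), §13.8 (p. 228)] [cite: Rubin2000, App. B Prop. B.2.3, B.3.3] -/
theorem exists_iwasawaH1_of_levelwise_from [CompactSpace ↥(padicCoeffIntegers S)] (hκ : κ.IsCyclotomic)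
    {γ : absoluteGaloisGroup ℚ} (I : IwasawaH1DataCoeff (FramedGaloisRep.toGaloisRep ρ) p κ γ) (N₀ : ℕ)
    (Sol : ∀ n k : ℕ, Set (H1 (cofreeTorsionGaloisModule S ρ ((p ^ k : ℕ) : ℤ)) (κ.layerSubgroup n)))
    (hfin : ∀ n k, N₀ ≤ n → (Sol n k).Finite) (hne : ∀ j, N₀ ≤ j → (Sol j j).Nonempty)
    (hSk : ∀ n k, N₀ ≤ n →
      ∀ c ∈ Sol n (k + 1), cohomologyMap (subgroupRepMap (cofreeTorsionPow S ρ k) (κ.layerSubgroup n)) 1 c ∈ Sol n k)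
    (hSn : ∀ n k, N₀ ≤ n →
      ∀ c ∈ Sol (n + 1) k, layerCores (cofreeTorsionGaloisModule S ρ ((p ^ k : ℕ) : ℤ)) κ n c ∈ Sol n k) :
    ∃ x : I.H, ∀ n k, N₀ ≤ n → (reduceH1CofreePkTorsion S ρ k (κ.layerSubgroup n) (I.proj n x) :
        H1 (cofreeTorsionGaloisModule S ρ ((p ^ k : ℕ) : ℤ)) (κ.layerSubgroup n)) ∈ Sol n k := by
  obtain ⟨Sol', hSol', hfin', hne', hSk', hSn'⟩ := exists_extension_below_floor S ρ κ N₀ Sol hfin hne hSk hSn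
  obtain ⟨x, hx⟩ := exists_iwasawaH1_of_levelwise S ρ κ hκ I Sol' hfin' hne' hSk' hSn'
  exact ⟨x, fun n k hn ↦ hSol' n k hn ▸ hx n k⟩

/-- `exists_layerFamily_of_levelwise_from` under the newform habitat's standing hypothesis `[FiniteDimensional ℚ_[p] ℚ_p(S)]`
(`UniversalNorms.compactSpace_padicCoeffIntegers`). [cite: Rubin2000, App. B Prop. B.2.3 and §B.3] -/
theorem exists_layerFamily_of_levelwise_from_of_finiteDimensional [FiniteDimensional ℚ_[p] ↥(padicCoeffField S)] (N₀ : ℕ)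
    (Sol : ∀ n k : ℕ, Set (H1 (cofreeTorsionGaloisModule S ρ ((p ^ k : ℕ) : ℤ)) (κ.layerSubgroup n)))
    (hfin : ∀ n k, N₀ ≤ n → (Sol n k).Finite) (hne : ∀ j, N₀ ≤ j → (Sol j j).Nonempty)
    (hSk : ∀ n k, N₀ ≤ n →
      ∀ c ∈ Sol n (k + 1), cohomologyMap (subgroupRepMap (cofreeTorsionPow S ρ k) (κ.layerSubgroup n)) 1 c ∈ Sol n k)
    (hSn : ∀ n k, N₀ ≤ n →
      ∀ c ∈ Sol (n + 1) k, layerCores (cofreeTorsionGaloisModule S ρ ((p ^ k : ℕ) : ℤ)) κ n c ∈ Sol n k) :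
    ∃ y : ∀ n : ℕ, H1 (FramedGaloisRep.toGaloisRep ρ) (κ.layerSubgroup n),
      (∀ n k, N₀ ≤ n → (reduceH1CofreePkTorsion S ρ k (κ.layerSubgroup n) (y n) :
          H1 (cofreeTorsionGaloisModule S ρ ((p ^ k : ℕ) : ℤ)) (κ.layerSubgroup n)) ∈ Sol n k) ∧
      ∀ n, layerCores (FramedGaloisRep.toGaloisRep ρ) κ n (y (n + 1)) = y n :=
  haveI := UniversalNorms.compactSpace_padicCoeffIntegers S
  exists_layerFamily_of_levelwise_from S ρ κ N₀ Sol hfin hne hSk hSn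

/-- `exists_iwasawaH1_of_levelwise_from` under the newform habitat's standing hypothesis `[FiniteDimensional ℚ_[p] ℚ_p(S)]`
(`UniversalNorms.compactSpace_padicCoeffIntegers`). [cite: Kato2004Asterisque, Lemma 8.5 (2) (p. 183), §12.2 (p. 220)]
[cite: Rubin2000, App. B Prop. B.2.3, B.3.3] -/
theorem exists_iwasawaH1_of_levelwise_from_of_finiteDimensional [FiniteDimensional ℚ_[p] ↥(padicCoeffField S)]
    (hκ : κ.IsCyclotomic) {γ : absoluteGaloisGroup ℚ} (I : IwasawaH1DataCoeff (FramedGaloisRep.toGaloisRep ρ) p κ γ) (N₀ : ℕ)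
    (Sol : ∀ n k : ℕ, Set (H1 (cofreeTorsionGaloisModule S ρ ((p ^ k : ℕ) : ℤ)) (κ.layerSubgroup n)))
    (hfin : ∀ n k, N₀ ≤ n → (Sol n k).Finite) (hne : ∀ j, N₀ ≤ j → (Sol j j).Nonempty)
    (hSk : ∀ n k, N₀ ≤ n →
      ∀ c ∈ Sol n (k + 1), cohomologyMap (subgroupRepMap (cofreeTorsionPow S ρ k) (κ.layerSubgroup n)) 1 c ∈ Sol n k)
    (hSn : ∀ n k, N₀ ≤ n →
      ∀ c ∈ Sol (n + 1) k, layerCores (cofreeTorsionGaloisModule S ρ ((p ^ k : ℕ) : ℤ)) κ n c ∈ Sol n k) :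
    ∃ x : I.H, ∀ n k, N₀ ≤ n → (reduceH1CofreePkTorsion S ρ k (κ.layerSubgroup n) (I.proj n x) :
        H1 (cofreeTorsionGaloisModule S ρ ((p ^ k : ℕ) : ℤ)) (κ.layerSubgroup n)) ∈ Sol n k :=
  haveI := UniversalNorms.compactSpace_padicCoeffIntegers S
  exists_iwasawaH1_of_levelwise_from S ρ κ hκ I N₀ Sol hfin hne hSk hSn

end Summit.BirchSwinnertonDyer.BirchSwinnertonDyer.Theorems.ThetaTransport

end
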